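import Summits.QuantumAdvantage.AdviceFreeQNC0.WalkTransport
import Mathlib.LinearAlgebra.StdBasis
import HarnessLib

/-!
# Cell qa-qnc0 (rung F-Q1, route RingFrame, crux α `RingToElim`): the HLF game of a general graph —
# the cycle case IS the ring relation, and the literal no-go N3 is misstated (planner qa-qnc0-p2 ROUND-7)

Planner qa-qnc0-p2 gen 7 (`HOME/qa-qnc0-p2/ROUND-7.md` §4, `line/Sketch7.lean` §3 "door D-G", asks
R7-a; statements VERBATIM below: `InKernelG`, `edgesInG`, `signBitG`, `RelG`, `cycleAdj`,
`RelGCycleIff`, `toZ`, `FewTypesEasy` — the two `Decidable` instances and `GraphHLFHardAt` of the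
sketch are not carried).

* `relGCycleIff : RelGCycleIff` — for `n ≥ 3` the graph game of the cycle `C_n` IS the tree's
  `RingHLF.Rel`: `InKernelG (cycleAdj n) x v ↔ InKernel x v` (the two neighbours `prv b ≠ nxt b` are
  distinct) and `edgesInG (cycleAdj n) v = edgesIn v` (the edge bijection `b ↦ {b, nxt b}`).
* **`not_fewTypesEasy : ¬ FewTypesEasy`** — the sketch's N3 ("few kernel types ⇒ easy") quantifies over
  ALL `adj : Fin m → Fin m → Bool`; symmetry and loop-freeness live only in its docstring, and with LOOPS
  it is false: `m = 2`, `adj = [a = b]` (two loops, no edge), `L = (e₀, e₁)`: every hypothesis holds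
  (`Ker_x = {v ≤ x}` is spanned by the `e_j` with `x_j = 1`), but at `x = (1,1)` the sign bits are
  `ℓ(e₀) = ℓ(e₁) = 0`, `ℓ(e₀ + e₁) = 1` — not additive, so NO output solves the instance.  MISSTATED:
  the intended statement carries `adj` symmetric with zero diagonal (then `ℓ_x` is additive on
  `Ker(A_G + diag x)` and the degree-`2` map of the sketch works); see the STATUS note of this seat.

WHAT THIS IS NOT: the repaired N3 (symmetric loop-free `adj`) is not proved in this file; nothing on α;
separation NOT moved.
-/

noncomputable section

namespace Summit.QuantumAdvantage.AdviceFreeQNC0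

open Finset
open Literature.Computability.QuantumComplexity Literature.Computability.QuantumComplexity.RingHLF
open Literature.Computability.MetaComplexity Literature.Computability.MetaComplexity.Smolensky

/-! ### Sketch7 §3 statements (verbatim) -/

section Graph

variable {m : ℕ}

/-- `v ∈ Ker(A_G + diag x)` over `𝔽₂` (`adj` a symmetric `0/1` adjacency matrix, no loops):
`Σ_{b' ~ b} v_{b'} + x_b v_b ≡ 0` at every vertex `b`.  (Planner qa-qnc0-p2 Sketch7, verbatim.) -/
def InKernelG (adj : Fin m → Fin m → Bool) (x v : Fin m → Bool) : Prop :=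
  ∀ b : Fin m,
    ((univ.filter fun b' : Fin m => adj b b' = true ∧ v b' = true).card +
      (if x b = true ∧ v b = true then 1 else 0)) % 2 = 0

/-- number of edges of `G` inside `supp v` (each unordered edge once).  (Sketch7, verbatim.) -/
def edgesInG (adj : Fin m → Fin m → Bool) (v : Fin m → Bool) : ℕ :=
  (univ.filter fun e : Fin m × Fin m => e.1 < e.2 ∧ adj e.1 e.2 = true ∧ v e.1 = true ∧ v e.2 = true).card

/-- the sign bit `ℓ_x(v) = (e(G[supp v]) + |x ∧ v|/2) mod 2` (value `q_x(v)/2` of the HLF form on a kernel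
vector).  (Sketch7, verbatim.) -/
def signBitG (adj : Fin m → Fin m → Bool) (x v : Fin m → Bool) : ℕ := (edgesInG adj v + wtAnd x v / 2) % 2

/-- **the HLF relation of the graph `G`**: `z` solves instance `x` iff `⟨v, z⟩ ≡ ℓ_x(v)` for all
`v ∈ Ker(A_G + diag x)`.  (Sketch7, verbatim.) -/
def RelG (adj : Fin m → Fin m → Bool) (x z : Fin m → Bool) : Prop :=
  ∀ v : Fin m → Bool, InKernelG adj x v → dot2 v z = signBitG adj x v

end Graph

/-- adjacency of the cycle `C_n` in the tree's convention (`nxt`, `prv`).  (Sketch7, verbatim.) -/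
def cycleAdj (n : ℕ) (b b' : Fin n) : Bool := decide (b' = nxt b ∨ b' = prv b)

/-- support (PROVABLE NOW, `n ≥ 3`): for the cycle the graph game IS the tree's ring relation.
(Sketch7, verbatim; proved below.) -/
def RelGCycleIff : Prop := ∀ n ≥ 3, ∀ x z : Fin n → Bool, RelG (cycleAdj n) x z ↔ Rel x z

/-- `0/1` vector as an `𝔽₂` vector.  (Sketch7, verbatim.) -/
def toZ {m : ℕ} (v : Fin m → Bool) : Fin m → ZMod 2 := fun i => if v i = true then 1 else 0

/-- **N3 (no-go: few kernel types ⇒ easy)** as typed by the planner (Sketch7, verbatim).  FALSE as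
stated, because `adj` is unrestricted (`not_fewTypesEasy`); true for symmetric loop-free `adj`. -/
def FewTypesEasy : Prop :=
  ∀ (m k : ℕ) (adj : Fin m → Fin m → Bool) (L : Fin k → (Fin m → Bool)),
    LinearIndependent (ZMod 2) (fun j => toZ (L j)) →
    (∀ x v : Fin m → Bool, InKernelG adj x v →
      toZ v ∈ Submodule.span (ZMod 2) (toZ '' {w | (∃ j, w = L j) ∧ InKernelG adj x w})) →
    ∃ s : Fin m → CubeFn (ZMod 2) m, (∀ i, s i ∈ lowDeg (ZMod 2) m 2) ∧
      ∀ x : Fin m → Bool, RelG adj x (fun i => decide (s i x = 1))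

/-! ### The cycle: `RelG (cycleAdj n) = Rel` -/

namespace GraphHLF

variable {n : ℕ}

/-- `nxt (nxt b) ≠ b` on a ring of length `≥ 3`. -/
theorem nxt_nxt_ne (hn : 3 ≤ n) (b : Fin n) : nxt (nxt b) ≠ b := by
  intro h
  have : prv b = nxt b := by
    have h2 := congrArg prv h
    rw [prv_nxt] at h2
    exact h2.symm
  exact prv_ne_nxt hn b this

/-- `nxt b ≠ b` on a ring of length `≥ 3`. -/
theorem nxt_ne (hn : 3 ≤ n) (b : Fin n) : nxt b ≠ b := by
  intro h
  exact nxt_nxt_ne hn b (by rw [h, h])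

/-- The two ring neighbours of `b`, filtered by `v`. -/
theorem filter_cycleAdj (hn : 3 ≤ n) (v : Fin n → Bool) (b : Fin n) :
    (univ.filter fun b' : Fin n => cycleAdj n b b' = true ∧ v b' = true).card =
      (if v (nxt b) = true then 1 else 0) + (if v (prv b) = true then 1 else 0) := by
  have hset : (univ.filter fun b' : Fin n => cycleAdj n b b' = true ∧ v b' = true) =
      ({nxt b, prv b} : Finset (Fin n)).filter fun b' => v b' = true := by
    ext b'
    simp only [cycleAdj, mem_filter, mem_univ, true_and, mem_insert, mem_singleton, decide_eq_true_eq]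
  rw [hset, filter_insert, filter_singleton]
  have hne : nxt b ≠ prv b := fun h => prv_ne_nxt hn b h.symm
  by_cases h1 : v (nxt b) = true <;> by_cases h2 : v (prv b) = true <;> simp [h1, h2, hne]

/-- **Kernels agree**: `InKernelG (cycleAdj n) x v ↔ InKernel x v` (`n ≥ 3`). -/
theorem inKernelG_cycle_iff (hn : 3 ≤ n) (x v : Fin n → Bool) :
    InKernelG (cycleAdj n) x v ↔ InKernel x v := by
  unfold InKernelG InKernel
  refine forall_congr' fun b => ?_
  rw [filter_cycleAdj hn v b]
  cases v (prv b) <;> cases v (nxt b) <;> cases x b <;> cases v b <;> simp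

/-- The edge map `b ↦ {b, nxt b}` as an ordered pair. -/
def edgeOf (b : Fin n) : Fin n × Fin n := if b < nxt b then (b, nxt b) else (nxt b, b)

/-- **Edge counts agree**: `edgesInG (cycleAdj n) v = edgesIn v` (`n ≥ 3`). -/
theorem edgesInG_cycle (hn : 3 ≤ n) (v : Fin n → Bool) : edgesInG (cycleAdj n) v = edgesIn v := by
  unfold edgesInG edgesIn
  symm
  refine Finset.card_bij (fun b _ => edgeOf b) (fun b hb => ?_) (fun b₁ hb₁ b₂ hb₂ h => ?_) (fun e he => ?_)
  · -- lands in the edge set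
    rw [mem_filter] at hb
    obtain ⟨_, hvb, hvn⟩ := hb
    unfold edgeOf
    by_cases hlt : b < nxt b
    · rw [if_pos hlt]
      exact mem_filter.2 ⟨mem_univ _, hlt, by simp [cycleAdj], hvb, hvn⟩
    · rw [if_neg hlt]
      exact mem_filter.2 ⟨mem_univ _, lt_of_le_of_ne (not_lt.1 hlt) (nxt_ne hn b),
        by simp [cycleAdj, prv_nxt], hvn, hvb⟩
  · -- injective
    unfold edgeOf at h
    by_cases h₁ : b₁ < nxt b₁ <;> by_cases h₂ : b₂ < nxt b₂
    · rw [if_pos h₁, if_pos h₂] at h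
      simp only [Prod.mk.injEq] at h
      exact h.1
    · rw [if_pos h₁, if_neg h₂] at h
      simp only [Prod.mk.injEq] at h
      obtain ⟨ha, hb⟩ := h
      have : nxt (nxt b₂) = b₂ := by rw [← ha, hb]
      exact absurd this (nxt_nxt_ne hn b₂)
    · rw [if_neg h₁, if_pos h₂] at h
      simp only [Prod.mk.injEq] at h
      obtain ⟨ha, hb⟩ := h
      have : nxt (nxt b₂) = b₂ := by rw [← hb, ha]
      exact absurd this (nxt_nxt_ne hn b₂)
    · rw [if_neg h₁, if_neg h₂] at h
      simp only [Prod.mk.injEq] at h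
      exact h.2
  · -- surjective
    simp only [mem_filter, mem_univ, true_and, cycleAdj, decide_eq_true_eq] at he
    obtain ⟨hlt, hadj, hv1, hv2⟩ := he
    rcases hadj with h | h
    · refine ⟨e.1, ?_, ?_⟩
      · rw [mem_filter]; exact ⟨mem_univ _, hv1, by rw [← h]; exact hv2⟩
      · unfold edgeOf
        rw [← h, if_pos hlt]
    · have hn1 : nxt e.2 = e.1 := by rw [h, nxt_prv]
      refine ⟨e.2, ?_, ?_⟩
      · rw [mem_filter]; exact ⟨mem_univ _, hv2, by rw [hn1]; exact hv1⟩
      · unfold edgeOf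
        rw [hn1, if_neg (not_lt.2 hlt.le)]

end GraphHLF

open GraphHLF

/-- **`RelGCycleIff` — PROVED**: for `n ≥ 3`, `RelG (cycleAdj n) x z ↔ Rel x z`. -/
theorem relGCycleIff : RelGCycleIff := by
  intro n hn x z
  unfold RelG RingHLF.Rel signBitG signBit
  refine forall_congr' fun v => ?_
  rw [inKernelG_cycle_iff hn, edgesInG_cycle hn]

/-! ### The literal N3 is false (loops) -/

namespace GraphHLF

/-- The looped "graph" on two vertices: `adj a b = [a = b]`. -/
def loopAdj : Fin 2 → Fin 2 → Bool := fun a b => decide (a = b)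

/-- The standard basis `e_j`. -/
def stdL : Fin 2 → (Fin 2 → Bool) := fun j i => decide (i = j)

/-- `toZ (e_j)` is the standard basis vector. -/
theorem toZ_stdL (j : Fin 2) : toZ (stdL j) = Pi.basisFun (ZMod 2) (Fin 2) j := by
  funext i
  rw [Pi.basisFun_apply]
  fin_cases i <;> fin_cases j <;> rfl

/-- For the looped graph the kernel at `x` is `{v : v ≤ x}`. -/
theorem inKernelG_loop_iff (x v : Fin 2 → Bool) :
    InKernelG loopAdj x v ↔ ∀ b, v b = true → x b = true := by
  unfold InKernelG
  refine forall_congr' fun b => ?_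
  have hset : (univ.filter fun b' : Fin 2 => loopAdj b b' = true ∧ v b' = true).card =
      if v b = true then 1 else 0 := by
    have : (univ.filter fun b' : Fin 2 => loopAdj b b' = true ∧ v b' = true) =
        ({b} : Finset (Fin 2)).filter fun b' => v b' = true := by
      ext b'
      simp only [loopAdj, mem_filter, mem_univ, true_and, mem_singleton, decide_eq_true_eq]
      constructor
      · rintro ⟨h1, h2⟩; exact ⟨h1.symm, h2⟩
      · rintro ⟨h1, h2⟩; exact ⟨h1.symm, h2⟩
    rw [this, filter_singleton]
    by_cases h : v b = true <;> simp [h]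
  rw [hset]
  cases v b <;> cases x b <;> simp

end GraphHLF

/-- **The literal `FewTypesEasy` is false**: the two-vertex looped "graph" `adj = [a = b]` with
`L = (e₀, e₁)` satisfies every hypothesis, but at `x = (1,1)` the sign bits `ℓ(e₀) = ℓ(e₁) = 0`,
`ℓ(e₀+e₁) = 1` are not additive on the kernel `𝔽₂²`, so no output solves that instance.
(MISSTATED: the intended N3 has `adj` symmetric with zero diagonal.) -/
theorem not_fewTypesEasy : ¬ FewTypesEasy := by
  intro h
  have hli : LinearIndependent (ZMod 2) (fun j => toZ (stdL j)) := by
    have e : (fun j => toZ (stdL j)) = fun j => (Pi.basisFun (ZMod 2) (Fin 2)) j :=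
      funext toZ_stdL
    rw [e]
    exact (Pi.basisFun (ZMod 2) (Fin 2)).linearIndependent
  have hspan : ∀ x v : Fin 2 → Bool, InKernelG loopAdj x v →
      toZ v ∈ Submodule.span (ZMod 2) (toZ '' {w | (∃ j, w = stdL j) ∧ InKernelG loopAdj x w}) := by
    intro x v hv
    rw [inKernelG_loop_iff] at hv
    have hdec : toZ v = ∑ j : Fin 2, (toZ v j) • toZ (stdL j) := by
      conv_lhs => rw [← (Pi.basisFun (ZMod 2) (Fin 2)).sum_repr (toZ v)]
      simp only [Pi.basisFun_repr, toZ_stdL]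
    rw [hdec]
    refine Submodule.sum_mem _ fun j _ => ?_
    by_cases hvj : v j = true
    · refine Submodule.smul_mem _ _ (Submodule.subset_span ⟨stdL j, ⟨⟨j, rfl⟩, ?_⟩, rfl⟩)
      rw [inKernelG_loop_iff]
      intro b hb
      unfold stdL at hb
      rw [decide_eq_true_eq] at hb
      rw [hb]; exact hv j hvj
    · have : toZ v j = 0 := by unfold toZ; rw [if_neg hvj]
      rw [this, zero_smul]
      exact Submodule.zero_mem _
  obtain ⟨s, _, hrel⟩ := h 2 2 loopAdj stdL hli hspan
  -- the instance `x = (1,1)`: every `v` is in the kernel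
  have hx := hrel (fun _ => true)
  generalize (fun i => decide (s i (fun _ : Fin 2 => true) = 1)) = z at hx
  have hker : ∀ v : Fin 2 → Bool, InKernelG loopAdj (fun _ => true) v := fun v => by
    rw [inKernelG_loop_iff]; intro b _; rfl
  have h0 := hx (stdL 0) (hker _)
  have h1 := hx (stdL 1) (hker _)
  have h2 := hx (fun _ => true) (hker _)
  have e0 : signBitG loopAdj (fun _ => true) (stdL 0) = 0 := by decide
  have e1 : signBitG loopAdj (fun _ => true) (stdL 1) = 0 := by decide
  have e2 : signBitG loopAdj (fun _ => true) (fun _ => true) = 1 := by decide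
  rw [e0] at h0; rw [e1] at h1; rw [e2] at h2
  unfold dot2 at h0 h1 h2
  rw [Finset.card_filter, Fin.sum_univ_two] at h0 h1 h2
  simp only [stdL, Fin.isValue, decide_true, true_and, show ((1 : Fin 2) = 0) = False by decide,
    decide_false, Bool.false_eq_true, false_and, if_false, add_zero, zero_add,
    show ((0 : Fin 2) = 1) = False by decide] at h0 h1 h2
  revert h0 h1 h2
  cases z 0 <;> cases z 1 <;> simp

end Summit.QuantumAdvantage.AdviceFreeQNC0
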